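import Literature.Analysis.FluidPDE.NewtonGradientPotential
import Literature.Analysis.FluidPDE.NewtonPotentialRepresentation
import Literature.Analysis.FluidPDE.HarmonicProbe
import Literature.Analysis.FluidPDE.HolderFieldCalculus
import HarnessLib

/-!
# The gradient of the Newtonian potential on `C^{k,α}` densities

Analysis/FluidPDE support file (everything proved, no definitions, no named facts) for the
discharge of the named fact
`Literature.Analysis.FluidPDE.jia_sverak_2014_local_higher_regularity`
(`JiaSverak2014LocalRegularity.lean`; H. Jia, V. Šverák, Invent. Math. 196 (2014) =
arXiv:1204.0529, §4 proof of Thm. 4.1, the bootstrapping of the proof of Thm. 3.2, arXiv p. 9: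
the localised pressure `pη` of a velocity that is `C^{k,γ}` near the ball has to be `C^{k,γ}`
there, with bounds). The elliptic input is the Hölder theory of the first-derivative potentials

  `T_j f (x) = ∫ ∂ⱼΓ(x − y) • f(y) dy`  (`newtonGradPotential (𝐞 j) f`, Gilbarg–Trudinger (4.9))

of the tree (`NewtonGradientPotential.lean`: `T_j f ∈ C^{1,γ}` with bounds for compactly
supported `γ`-Hölder `f`, Majda–Bertozzi (4.38)–(4.39) / Gilbarg–Trudinger Lemma 4.4), pushed
to all orders by moving derivatives onto the density:

* `newtonGradPotential_single_eq_integral_comp_sub` — `T_j f(x) = ∫ ∂ⱼΓ(z) • f(x − z) dz`;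
* `hasFDerivAt_newtonGradPotential_single`, `fderiv_newtonGradPotential_single` —
  **`D(T_j f) = T_j(Df)`** for `f ∈ C¹_c` (differentiation under the integral sign, the kernel
  truncated to a ball where it is integrable; Gilbarg–Trudinger Lemma 4.1);
* `exists_isHolderField_newtonGradPotential_single` — **`f ∈ C^{k,1/2}_c ⇒ T_j f ∈ C^{k+1,1/2}`**
  with constant `C(k, R) · A` for densities supported in a ball of radius `R` (induction on `k`,
  the density taking values in iterated spaces of continuous linear maps);
* `IsHolderField.coord_mul_coord` — the products `aᵢaⱼ` of the coordinates of a Hölder field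
  (the densities of the pressure `−Δ⁻¹∂ᵢ∂ⱼ(aᵢaⱼ)`, `HolderPressure.lean`).

## Mathlib / tree search

Tree (used): `newtonGradPotential`, `exists_newtonGradPotential_bounds`,
`contDiff_one_newtonGradPotential`, `hasFDerivAt_newtonGradPotential` (`NewtonGradientPotential`);
`NewtonPotentialHolder.isSingularKernel_newtonKernelGrad`, `newtonKernelGrad_eq_fderiv`,
`integrableOn_ball_norm_rpow_neg` (`NewtonPotentialHolder`); `hasFDerivAt_integral_smul_comp_sub`
(`HarmonicProbe`); `IsHolderField.{fderiv_right, of_fderiv_right, coord, smul, fderiv_apply, sum, neg,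
mono_const, norm_iteratedFDeriv_sub_le}` (`HolderFieldCalculus`, `OseenSliceHolder`,
`ForcedHeatDuhamelHolder`). Mathlib: `integral_sub_left_eq_self`, `Set.indicator`.

## References

* H. Jia, V. Šverák, Invent. Math. 196 (2014) = arXiv:1204.0529, §4 proof of Thm. 4.1, §3 proof
  of Thm. 3.2 (p. 9). Bib key `JiaSverak2014`.
* D. Gilbarg, N. S. Trudinger, *Elliptic Partial Differential Equations of Second Order* (2001),
  Lemmas 4.1, 4.2, 4.4. Bib key `GilbargTrudinger2001`.
* A. J. Majda, A. L. Bertozzi, *Vorticity and Incompressible Flow* (CUP 2002), §4.1.3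
  (4.38)–(4.39). Bib key `MajdaBertozziCUP2002`.
-/

noncomputable section

open MeasureTheory Set Function Filter Metric Real
open _root_.Topology
open scoped NNReal ENNReal ContDiff

universe u

namespace Literature.Analysis.FluidPDE

open NewtonPotentialHolder

/-- Local notation for physical space `ℝ³ = EuclideanSpace ℝ (Fin 3)`. -/
local notation "ℝ³" => EuclideanSpace ℝ (Fin 3)

/-- Local notation for the standard basis vectors of `ℝ³`. -/
local notation "𝐞" i => EuclideanSpace.single (i : Fin 3) (1 : ℝ)

/-! ### `C^{0,α}` data from bounds; lowering the order to zero -/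

section Zero

variable {E : Type*} [NormedAddCommGroup E] [NormedSpace ℝ E]
variable {F : Type*} [NormedAddCommGroup F] [NormedSpace ℝ F]

/-- **`C^{0,α}` from a sup bound and a Hölder bound** (continuity, `‖g‖ ≤ A`, `[g]_α ≤ A`). [folklore] -/
theorem isHolderField_zero_of_bounds {g : E → F} {α A : ℝ} (hc : Continuous g) (h0 : ∀ x, ‖g x‖ ≤ A)
    (hH : ∀ x y, ‖g x - g y‖ ≤ A * ‖x - y‖ ^ α) : IsHolderField 0 α A g := by
  refine ⟨contDiff_zero.2 hc, fun j hj x => ?_, fun x y => ?_⟩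
  · obtain rfl : j = 0 := Nat.le_zero.1 hj
    rw [norm_iteratedFDeriv_zero]; exact h0 x
  · rw [iteratedFDeriv_zero_eq_comp, Function.comp_apply, Function.comp_apply,
      ← LinearIsometryEquiv.map_sub, LinearIsometryEquiv.norm_map]
    exact hH x y

/-- **Lowering the order to zero**: a `C^{k,α}` field with constant `A` is `C^{0,α}` with constant
`2A` (`0 ≤ α ≤ 1`). [folklore] -/
theorem IsHolderField.order_zero {g : E → F} {k : ℕ} {α A : ℝ} (h : IsHolderField k α A g)
    (hα0 : 0 ≤ α) (hα1 : α ≤ 1) : IsHolderField 0 α (2 * A) g := by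
  have hA := h.nonneg
  refine isHolderField_zero_of_bounds h.continuous (fun x => (h.norm_apply_le x).trans (by linarith))
    fun x y => ?_
  have := h.norm_iteratedFDeriv_sub_le hα0 hα1 (Nat.zero_le k) x y
  rwa [iteratedFDeriv_zero_eq_comp, Function.comp_apply, Function.comp_apply,
    ← LinearIsometryEquiv.map_sub, LinearIsometryEquiv.norm_map] at this

end Zero

/-! ### The kernel `∂ⱼΓ` truncated to a ball -/

/-- `∂ⱼΓ` is integrable on every closed ball (`|∂ⱼΓ(z)| ≤ (4π)⁻¹|z|⁻²` and `2 < 3`). [folklore] -/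
theorem integrableOn_newtonKernelGrad_closedBall (j : Fin 3) (ρ : ℝ) :
    IntegrableOn (newtonKernelGrad j) (closedBall (0 : ℝ³) ρ) volume := by
  have hk := isSingularKernel_newtonKernelGrad j
  refine IntegrableOn.mono_set ?_ (closedBall_subset_ball (lt_add_one ρ))
  refine Integrable.mono' (((integrableOn_ball_norm_rpow_neg (by norm_num : (2 : ℝ) < 3) (ρ + 1))).const_mul
    ((4 * Real.pi)⁻¹)) hk.measurable.aestronglyMeasurable (Eventually.of_forall fun z => ?_)
  rw [Real.norm_eq_abs]
  exact hk.abs_le z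

/-- The truncated kernel `1_{B̄(0,ρ)} ∂ⱼΓ` is integrable. [folklore] -/
theorem integrable_indicator_newtonKernelGrad (j : Fin 3) (ρ : ℝ) :
    Integrable ((closedBall (0 : ℝ³) ρ).indicator (newtonKernelGrad j)) volume :=
  (integrableOn_newtonKernelGrad_closedBall j ρ).integrable_indicator measurableSet_closedBall

/-- The truncated kernel vanishes off the ball of radius `ρ`. [folklore] -/
theorem indicator_newtonKernelGrad_eq_zero {ρ : ℝ} {z : ℝ³} (hz : ρ < ‖z‖) (j : Fin 3) :
    (closedBall (0 : ℝ³) ρ).indicator (newtonKernelGrad j) z = 0 :=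
  indicator_of_notMem (fun h => not_le.2 hz (mem_closedBall_zero_iff.1 h)) _

/-! ### `T_j f` as an integral of translates, and `D(T_j f) = T_j(Df)` -/

section Density

variable {F : Type*} [NormedAddCommGroup F] [NormedSpace ℝ F]

/-- **`T_j f(x) = ∫ ∂ⱼΓ(z) • f(x − z) dz`** for every density `f` (change of variables
`y = x − z`; the kernel `DΓ(·)eⱼ` is the everywhere-defined `newtonKernelGrad j`). [folklore] -/
theorem newtonGradPotential_single_eq_integral_comp_sub (j : Fin 3) (f : ℝ³ → F) (x : ℝ³) :
    newtonGradPotential (𝐞 j) f x = ∫ z, newtonKernelGrad j z • f (x - z) := by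
  rw [newtonGradPotential]
  have e : (fun y => fderiv ℝ newtonKernel (x - y) (𝐞 j) • f y) =
      fun y => newtonKernelGrad j (x - y) • f (x - (x - y)) := by
    funext y
    rw [NewtonPotentialRepresentation.newtonKernelGrad_eq_fderiv_newtonKernel, sub_sub_cancel]
  rw [e]
  exact integral_sub_left_eq_self (fun z => newtonKernelGrad j z • f (x - z)) volume x

/-- **The truncation is invisible for compactly supported densities**: if `tsupport g ⊆ B̄(0, R)`
and `‖x‖ + R < ρ`, then `T_j g(x) = ∫ (1_{B̄(0,ρ)}∂ⱼΓ)(z) • g(x − z) dz`. [folklore] -/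
theorem newtonGradPotential_single_eq_integral_indicator (j : Fin 3) {g : ℝ³ → F} {R ρ : ℝ}
    (hg : tsupport g ⊆ closedBall (0 : ℝ³) R) {x : ℝ³} (hx : ‖x‖ + R < ρ) :
    newtonGradPotential (𝐞 j) g x =
      ∫ z, (closedBall (0 : ℝ³) ρ).indicator (newtonKernelGrad j) z • g (x - z) := by
  rw [newtonGradPotential_single_eq_integral_comp_sub]
  refine integral_congr_ae (Eventually.of_forall fun z => ?_)
  show newtonKernelGrad j z • g (x - z) = (closedBall (0 : ℝ³) ρ).indicator (newtonKernelGrad j) z • g (x - z)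
  by_cases hz : z ∈ closedBall (0 : ℝ³) ρ
  · rw [indicator_of_mem hz]
  · have hgz : g (x - z) = 0 := by
      refine image_eq_zero_of_notMem_tsupport fun h => hz ?_
      have h1 : ‖x - z‖ ≤ R := mem_closedBall_zero_iff.1 (hg h)
      rw [mem_closedBall_zero_iff]
      have : ‖z‖ ≤ ‖x‖ + ‖x - z‖ := by
        calc ‖z‖ = ‖x - (x - z)‖ := by rw [sub_sub_cancel]
          _ ≤ ‖x‖ + ‖x - z‖ := norm_sub_le _ _
      linarith
    simp only [hgz, smul_zero]

/-- **`D(T_j f) = T_j(Df)` for `f ∈ C¹_c`** (Gilbarg–Trudinger Lemma 4.1, with the derivative on the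
density: in `T_j f(x) = ∫ ∂ⱼΓ(z) f(x − z) dz` one differentiates under the integral sign, the
locally integrable kernel being truncated to a ball outside of which the translates of `f`
vanish). The derivative `T_j(Df)(x) = ∫ ∂ⱼΓ(x − y) • Df(y) dy` is the potential of the
`(ℝ³ →L F)`-valued density `Df`. [cite: GilbargTrudinger2001, Lemma 4.1] -/
theorem hasFDerivAt_newtonGradPotential_single {f : ℝ³ → F} (hf : ContDiff ℝ 1 f)
    (hfc : HasCompactSupport f) (j : Fin 3) (x : ℝ³) :
    HasFDerivAt (newtonGradPotential (𝐞 j) f) (newtonGradPotential (𝐞 j) (fderiv ℝ f) x) x := by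
  obtain ⟨R, hR⟩ : ∃ R : ℝ, tsupport f ⊆ closedBall (0 : ℝ³) R :=
    (hfc.isCompact.isBounded).subset_closedBall 0
  set ρ : ℝ := ‖x‖ + |R| + 2 with hρ
  set k : ℝ³ → ℝ := (closedBall (0 : ℝ³) ρ).indicator (newtonKernelGrad j) with hk
  have hki : Integrable k volume := integrable_indicator_newtonKernelGrad j ρ
  have hkρ : ∀ z, ρ < ‖z‖ → k z = 0 := fun z hz => indicator_newtonKernelGrad_eq_zero hz j
  have hD := hasFDerivAt_integral_smul_comp_sub hki hkρ hf x
  -- the truncated integral is `T_j f` near `x`, and its derivative is `T_j (Df)(x)`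
  have hR' : tsupport f ⊆ closedBall (0 : ℝ³) |R| := hR.trans (closedBall_subset_closedBall (le_abs_self R))
  have hDR : tsupport (fderiv ℝ f) ⊆ closedBall (0 : ℝ³) |R| := (tsupport_fderiv_subset ℝ).trans hR'
  have hev : (fun x' => ∫ z, k z • f (x' - z)) =ᶠ[𝓝 x] newtonGradPotential (𝐞 j) f := by
    filter_upwards [ball_mem_nhds x one_pos] with x' hx'
    refine (newtonGradPotential_single_eq_integral_indicator j hR' ?_).symm
    have : ‖x'‖ < ‖x‖ + 1 := by
      calc ‖x'‖ = ‖x + (x' - x)‖ := by rw [add_sub_cancel]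
        _ ≤ ‖x‖ + ‖x' - x‖ := norm_add_le _ _
        _ < ‖x‖ + 1 := by rw [← dist_eq_norm]; linarith [mem_ball.1 hx']
    rw [hρ]; linarith
  have hval : (∫ z, k z • fderiv ℝ f (x - z)) = newtonGradPotential (𝐞 j) (fderiv ℝ f) x :=
    (newtonGradPotential_single_eq_integral_indicator j hDR (by rw [hρ]; linarith)).symm
  rw [← hval]
  exact hD.congr_of_eventuallyEq hev.symm

/-- `D(T_j f) = T_j(Df)` as functions, `f ∈ C¹_c`. [cite: GilbargTrudinger2001, Lemma 4.1] -/
theorem fderiv_newtonGradPotential_single {f : ℝ³ → F} (hf : ContDiff ℝ 1 f)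
    (hfc : HasCompactSupport f) (j : Fin 3) :
    fderiv ℝ (newtonGradPotential (𝐞 j) f) = newtonGradPotential (𝐞 j) (fderiv ℝ f) :=
  funext fun x => (hasFDerivAt_newtonGradPotential_single hf hfc j x).fderiv

end Density

/-! ### `T_j` maps `C^{k,1/2}_c` to `C^{k+1,1/2}` -/

/-- `(1/2 : ℝ).toNNReal = 1/2`. [folklore] -/
theorem toNNReal_one_half : (1 / 2 : ℝ).toNNReal = (1 / 2 : ℝ≥0) := by
  ext; simp

/-- **The base case: `f ∈ C^{0,1/2}_c ⇒ T_j f ∈ C^{1,1/2}`** with constant `C (6 + R³) A` for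
densities with constant `A` supported in `B̄(c, R)`, `0 ≤ R` (the tree's Majda–Bertozzi bounds
(4.38)–(4.39), `exists_newtonGradPotential_bounds`, repackaged). [cite: MajdaBertozziCUP2002, §4.1.3 (4.38)–(4.39) (p. 129)] -/
theorem exists_isHolderField_one_newtonGradPotential_single {F : Type*} [NormedAddCommGroup F]
    [NormedSpace ℝ F] [CompleteSpace F] {R : ℝ} (hR : 0 ≤ R) :
    ∃ C : ℝ, 0 ≤ C ∧ ∀ {f : ℝ³ → F} {A : ℝ} {c : ℝ³} (j : Fin 3),
      IsHolderField 0 (1 / 2) A f → tsupport f ⊆ closedBall c R →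
        IsHolderField 1 (1 / 2) (C * A) (newtonGradPotential (𝐞 j) f) := by
  obtain ⟨C₀, hC₀0, hC₀⟩ := exists_newtonGradPotential_bounds (F := F)
  refine ⟨C₀ * (6 + R ^ 3), by positivity, fun {f A c} j hf hsupp => ?_⟩
  have hA := hf.nonneg
  have hfc : HasCompactSupport f :=
    HasCompactSupport.of_support_subset_isCompact (isCompact_closedBall c R)
      (subset_tsupport f |>.trans hsupp)
  have hH : HolderWith A.toNNReal (1 / 2 : ℝ≥0) f := by
    have := hf.holderWith (by norm_num : (0 : ℝ) ≤ 1 / 2)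
    rwa [toNNReal_one_half] at this
  have hγ0 : (0 : ℝ≥0) < 1 / 2 := by norm_num
  have hγ1 : (1 / 2 : ℝ≥0) < 1 := by
    rw [← NNReal.coe_lt_coe]; norm_num
  obtain ⟨h0, h1, h2⟩ := hC₀ (𝐞 j) f A.toNNReal (1 / 2) A R c hH hγ0 hγ1 hf.norm_apply_le hsupp hR
  have hn1 : ‖(𝐞 j : ℝ³)‖ = 1 := by simp
  have hAt : ((A.toNNReal : ℝ≥0) : ℝ) = A := Real.coe_toNNReal A hA
  have hhalf : (((1 / 2 : ℝ≥0) : ℝ)) = 1 / 2 := by norm_num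
  simp only [hn1, mul_one, hAt, hhalf] at h0 h1 h2
  -- the three bounds against the single constant `C₀ (6 + R³) A`
  have hR3 : 0 ≤ R ^ 3 := by positivity
  have b0 : ∀ x, ‖newtonGradPotential (𝐞 j) f x‖ ≤ C₀ * (6 + R ^ 3) * A := fun x =>
    (h0 x).trans (by nlinarith [mul_nonneg hC₀0 hA])
  have b1 : ∀ x, ‖fderiv ℝ (newtonGradPotential (𝐞 j) f) x‖ ≤ C₀ * (6 + R ^ 3) * A := fun x => by
    refine (h1 x).trans ?_
    have : A / (1 / 2) + A * R ^ 3 = A * (2 + R ^ 3) := by ring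
    rw [this]; nlinarith [mul_nonneg hC₀0 hA]
  have b2 : ∀ x y, ‖fderiv ℝ (newtonGradPotential (𝐞 j) f) x - fderiv ℝ (newtonGradPotential (𝐞 j) f) y‖ ≤
      C₀ * (6 + R ^ 3) * A * ‖x - y‖ ^ (1 / 2 : ℝ) := fun x y => by
    refine (h2 x y).trans ?_
    have e : A * (1 / (1 / 2) + 1 / (1 - 1 / 2) + 1) + A * R ^ 3 = A * (5 + R ^ 3) := by ring
    rw [e]
    have : C₀ * (A * (5 + R ^ 3)) ≤ C₀ * (6 + R ^ 3) * A := by nlinarith [mul_nonneg hC₀0 hA]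
    exact mul_le_mul_of_nonneg_right this (Real.rpow_nonneg (norm_nonneg _) _)
  -- assemble `C^{1,1/2}` through `of_fderiv_right`
  have hc1 : ContDiff ℝ 1 (newtonGradPotential (𝐞 j) f) := contDiff_one_newtonGradPotential _ hH hγ0 hγ1 hfc
  have hD0 : IsHolderField 0 (1 / 2) (C₀ * (6 + R ^ 3) * A) (fderiv ℝ (newtonGradPotential (𝐞 j) f)) :=
    isHolderField_zero_of_bounds (hc1.continuous_fderiv one_ne_zero) b1 b2
  exact IsHolderField.of_fderiv_right (hc1.differentiable one_ne_zero) hD0 b0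

/-- **`T_j` maps `C^{k,1/2}_c` to `C^{k+1,1/2}`, every `k`** (Gilbarg–Trudinger Lemma 4.4 at all
orders): for every `k` and `R ≥ 0` there is `C = C(k, R)` (depending also on the value space)
such that for every density `f` which is `C^{k,1/2}` with constant `A` and supported in a ball
`B̄(c, R)`, `T_j f` is `C^{k+1,1/2}` with constant `C A`. Induction on `k`: `D(T_j f) = T_j(Df)`
with `Df` a `C^{k,1/2}_c` density valued in `ℝ³ →L F`. [cite: GilbargTrudinger2001, Lemma 4.4] -/
theorem exists_isHolderField_newtonGradPotential_single (k : ℕ) :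
    ∀ {F : Type u} [NormedAddCommGroup F] [NormedSpace ℝ F] [CompleteSpace F] {R : ℝ}, 0 ≤ R →
      ∃ C : ℝ, 0 ≤ C ∧ ∀ {f : ℝ³ → F} {A : ℝ} {c : ℝ³} (j : Fin 3),
        IsHolderField k (1 / 2) A f → tsupport f ⊆ closedBall c R →
          IsHolderField (k + 1) (1 / 2) (C * A) (newtonGradPotential (𝐞 j) f) := by
  induction k with
  | zero =>
    intro F _ _ _ R hR
    exact exists_isHolderField_one_newtonGradPotential_single hR
  | succ k ih =>
    intro F _ _ _ R hR
    -- the constant of order `k` for `(ℝ³ →L F)`-valued densities, and the order-zero constant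
    obtain ⟨C₁, hC₁0, hC₁⟩ := ih (F := ℝ³ →L[ℝ] F) hR
    obtain ⟨C₀, hC₀0, hC₀⟩ := exists_isHolderField_one_newtonGradPotential_single (F := F) hR
    refine ⟨C₁ + 2 * C₀, by positivity, fun {f A c} j hf hsupp => ?_⟩
    have hA := hf.nonneg
    have hfc : HasCompactSupport f :=
      HasCompactSupport.of_support_subset_isCompact (isCompact_closedBall c R)
        (subset_tsupport f |>.trans hsupp)
    have hf1 : ContDiff ℝ 1 f := hf.contDiff.of_le (by exact_mod_cast Nat.le_add_left 1 k)
    -- `Df ∈ C^{k,1/2}_c`, so `T_j(Df) ∈ C^{k+1,1/2}` with constant `C₁ A`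
    have hDf : IsHolderField k (1 / 2) A (fderiv ℝ f) := hf.fderiv_right
    have hDsupp : tsupport (fderiv ℝ f) ⊆ closedBall c R := (tsupport_fderiv_subset ℝ).trans hsupp
    have hT1 : IsHolderField (k + 1) (1 / 2) (C₁ * A) (newtonGradPotential (𝐞 j) (fderiv ℝ f)) :=
      hC₁ j hDf hDsupp
    -- `D(T_j f) = T_j(Df)` and the sup bound of `T_j f` from order zero
    have hDT : fderiv ℝ (newtonGradPotential (𝐞 j) f) = newtonGradPotential (𝐞 j) (fderiv ℝ f) :=
      fderiv_newtonGradPotential_single hf1 hfc j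
    have hdiff : Differentiable ℝ (newtonGradPotential (𝐞 j) f) := fun x =>
      (hasFDerivAt_newtonGradPotential_single hf1 hfc j x).differentiableAt
    have hf0 : IsHolderField 0 (1 / 2) (2 * A) f :=
      hf.order_zero (by norm_num) (by norm_num)
    have hT0 : IsHolderField 1 (1 / 2) (C₀ * (2 * A)) (newtonGradPotential (𝐞 j) f) := hC₀ j hf0 hsupp
    have hsup : ∀ x, ‖newtonGradPotential (𝐞 j) f x‖ ≤ (C₁ + 2 * C₀) * A := fun x => by
      have := hT0.norm_apply_le x
      nlinarith [mul_nonneg hC₁0 hA]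
    have hT1' : IsHolderField (k + 1) (1 / 2) ((C₁ + 2 * C₀) * A) (fderiv ℝ (newtonGradPotential (𝐞 j) f)) := by
      rw [hDT]
      exact hT1.mono_const (by nlinarith [mul_nonneg hC₀0 hA])
    exact IsHolderField.of_fderiv_right hdiff hT1' hsup

/-! ### The densities `aᵢaⱼ` -/

/-- **The products `aᵢaⱼ` of the coordinates of a `C^{k,α}` field are `C^{k,α}`** with constant
`2^{k+2} A²` (`0 ≤ α ≤ 1`), supported in `tsupport a`. [folklore] -/
theorem IsHolderField.coord_mul_coord {k : ℕ} {α A : ℝ} {a : ℝ³ → ℝ³} (h : IsHolderField k α A a)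
    (hα0 : 0 ≤ α) (hα1 : α ≤ 1) (i j : Fin 3) :
    IsHolderField k α (2 ^ (k + 2) * A * A) fun y => a y i * a y j := by
  have := (h.coord i).smul (h.coord j) hα0 hα1
  simpa only [smul_eq_mul] using this

/-- The support of `aᵢaⱼ` is contained in that of `a`. [folklore] -/
theorem tsupport_coord_mul_coord_subset (a : ℝ³ → ℝ³) (i j : Fin 3) :
    tsupport (fun y => a y i * a y j) ⊆ tsupport a := by
  refine closure_mono fun y hy => ?_
  rw [mem_support] at hy ⊢
  intro h0
  exact hy (by simp [h0])

end Literature.Analysis.FluidPDE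

end
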